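import Summits.ResolutionOfSingularities.ResolutionOfSingularities.Theorems.EquisingularLiftEquisingularLiftBlowupModelFirstOrderLine
import Summits.ResolutionOfSingularities.ResolutionOfSingularities.Theorems.EquisingularLiftEquisingularLiftNatFirstOrderLinSubst
import HarnessLib

/-!
# [OURS] FIRST-ORDER LINEAR SINGULAR LOCI IN ANY LINEAR POSITION: EL♮ (cruxes 20038 / 20148) and regular blow-up models (crux 15660) for `(H, ι)` whose
# image has, in SOME linear coordinates, a first-order coordinate `ℙʳ` as singular locus

[OURS · leafhand-res-equisingularlift-9 g0, 2026-08-31; cell `pub/decomp-res`] AI-produced, weaker than expert review; NOT a statement of any manuscript;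
nothing here proves resolution of singularities.  DEF-FREE helper; no `sorry`; standard axioms; ZERO named hypotheses.

✓ `FirstOrderLine.elNatAt_firstOrderLine` / ✓ `StrataSplit.blowupModel_firstOrderLine` ask the singular `ℙʳ` to be a COORDINATE subspace.  Any linear
`ℙʳ ⊂ ℙ^{m+2}` becomes one after `x' = τ(x)`; the conclusions travel back along `α_τ ∈ PGL` (✓ `QuadricELNat.elNatAt_of_elNatAt_linSubst`,
✓ `exists_closedImmersion_range_eq_of_linSubst` + ✓ `blowupModel_of_range_eq`), exactly as for points (…NatFirstOrderLinSubst):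

* ★★ `FirstOrderLine.elNatAt_of_linSubst_firstOrderLine` — `K = K̄` of characteristic `p`, `range ι = V₊(F)`, `F` prime, `τ, τ'` mutually inverse linear
  substitutions such that `G = σ_{τ'}F` satisfies the hypotheses of `elNatAt_firstOrderLine`: `ELNatAt p K (m+2) H ι`;
* ★★ `StrataSplit.blowupModel_of_range_eq_of_linSubst_firstOrderLine` — the same in the currency of crux 15660.

E.g. every integral surface in `ℙ³_K̄` of any degree whose singular locus is ONE line of first-order type (transversal `A₁`/`A₂` generically, pinch points
allowed where the `u`-derivative of the tangent cone keeps the criterion), every characteristic.  Honest label: closes no registered stub.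
-/

set_option linter.dupNamespace false -- mandated namespace `Summit.<Summit>.<Problem>` of this single-conjunct summit

noncomputable section

open CategoryTheory CategoryTheory.Limits AlgebraicGeometry TopologicalSpace
open MvPolynomial
open Literature.AlgebraicGeometry.Resolution
open Literature.AlgebraicGeometry.Motives Literature.AlgebraicGeometry.Motives.SmoothHypersurface
open Literature.AlgebraicGeometry.Motives.ProjectiveSpace
open Summit.ResolutionOfSingularities.ResolutionOfSingularities.Cruxes.EquisingularLift.StrataSplit

namespace Summit.ResolutionOfSingularities.ResolutionOfSingularities.Cruxes.EquisingularLiftNat.Sections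

namespace FirstOrderLine

/-- ★★ **EL♮ for every `(H, ι)` whose image has, IN SOME LINEAR COORDINATES, a first-order coordinate `ℙʳ` as singular locus** (`K = K̄` of characteristic
`p`, any dimension, any degree): the hypotheses of ✓ `elNatAt_firstOrderLine` for `G = σ_{τ'}F` (`τ, τ'` mutually inverse linear substitutions;
`G` is a prime form, ✓ `prime_aeval_of_linSubst`), carried back along `α_τ` (✓ `QuadricELNat.elNatAt_of_elNatAt_linSubst`).
[OURS] [cite: Hartshorne1977, II Example 7.1.1, II Ex. 7.12] -/
theorem elNatAt_of_linSubst_firstOrderLine {K : Type} [Field K] (p : ℕ) (hp : p.Prime) [CharP K p] [IsAlgClosed K] {m : ℕ}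
    {H : Scheme.{0}} (ι : H ⟶ (projectiveSpace (m + 1 + 1) K).left) [IsClosedImmersion ι]
    (F : MvPolynomial (Fin (m + 1 + 1 + 1)) K) {d : ℕ} (hF : F.IsHomogeneous d) (hFp : Prime F)
    (hrange : letI := MvPolynomial.gradedAlgebra (σ := Fin (m + 1 + 1 + 1)) (R := K)
      Set.range ι = {x : Proj (homogeneousSubmodule (Fin (m + 1 + 1 + 1)) K) | F ∈ x.asHomogeneousIdeal})
    (τ τ' : Fin (m + 1 + 1 + 1) → MvPolynomial (Fin (m + 1 + 1 + 1)) K) (hτ : ∀ i, (τ i).IsHomogeneous 1) (hτ' : ∀ i, (τ' i).IsHomogeneous 1)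
    (hinv : ∀ i, aeval τ (τ' i) = X i) (hinv' : ∀ i, aeval τ' (τ i) = X i)
    {r : ℕ} (e : Fin (r + 1) → Fin (m + 2 + 1)) (he : Function.Injective e)
    (hFmem : aeval τ' F ∈ Ideal.span ((fun a => (X a : MvPolynomial (Fin (m + 2 + 1)) K)) '' {a | a ∉ Set.range e}))
    (hXa : ∃ a, a ∉ Set.range e ∧ (X a : MvPolynomial (Fin (m + 2 + 1)) K) ∉ Ideal.span {aeval τ' F})
    (hoff : letI := MvPolynomial.gradedAlgebra (σ := Fin (m + 2 + 1)) (R := K)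
      ∀ (hG : (aeval τ' F).IsHomogeneous d) (c : Fin (m + 2 + 1)), c ∉ Set.range e → IsRegularRing (ChartRing (aeval τ' F) c hG))
    (hfo : ∀ c ∈ Set.range e, ∃ (M : ℕ) (R : Type) (_ : CommRing R) (_ : IsDomain R)
      (σ : MvPolynomial (Fin (m + 2)) K ≃+* MvPolynomial (Fin (M + 1)) R),
      (∀ j : Fin (m + 2), c.succAbove j ∉ Set.range e → ∃ i : Fin (M + 1), σ (X j) = X i) ∧
      (∀ i : Fin (M + 1), ∃ j : Fin (m + 2), c.succAbove j ∉ Set.range e ∧ σ (X j) = X i) ∧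
      ∃ (Φ Ψ₁ Ψ' : MvPolynomial (Fin (M + 1)) R) (μ : ℕ), Φ.IsHomogeneous μ ∧ Φ ≠ 0 ∧ Ψ₁.IsHomogeneous (μ + 1) ∧
        Ψ' ∈ Ideal.span (Set.range (X : Fin (M + 1) → MvPolynomial (Fin (M + 1)) R)) ^ (μ + 2) ∧
        σ (ProjectiveSpace.dehomogenize K c (aeval τ' F)) = Φ + (Ψ₁ + Ψ') ∧
        ∃ (ι' : Type) (_ : Finite ι') (ρ : MvPolynomial ι' K ≃+* MvPolynomial (Fin (M + 1)) R) (ιz : Fin (M + 1) → ι'),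
          (∀ (j : Fin (M + 1)) (q : MvPolynomial (Fin (M + 1)) R), ρ (pderiv (ιz j) (ρ.symm q)) = pderiv j q) ∧
          (∀ v, v ∉ Set.range ιz → ∀ j : Fin (M + 1), ρ (pderiv v (ρ.symm (X j))) = 0) ∧
          (∀ v, v ∉ Set.range ιz → ∀ a : R, ∃ a' : R, ρ (pderiv v (ρ.symm (C a))) = C a') ∧
          ∀ P : Ideal (MvPolynomial (Fin (M + 1)) R), P.IsPrime → Φ ∈ P → (∀ v : ι', ρ (pderiv v (ρ.symm Φ)) ∈ P) → Ψ₁ ∈ P →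
            ∀ j, (X j : MvPolynomial (Fin (M + 1)) R) ∈ P) :
    Theorems.EquisingularLift.ELNatAt p K (m + 1 + 1) H ι := by
  have hG : (aeval τ' F).IsHomogeneous d := by
    have h := hF.aeval τ' hτ'
    rwa [one_mul] at h
  exact QuadricELNat.elNatAt_of_elNatAt_linSubst τ τ' hτ hτ' hinv hinv' p ι F hrange
    (elNatAt_firstOrderLine p hp K (aeval τ' F) hG (prime_aeval_of_linSubst τ τ' hinv hinv' hFp) e he hFmem hXa (hoff hG) hfo)

end FirstOrderLine

end Summit.ResolutionOfSingularities.ResolutionOfSingularities.Cruxes.EquisingularLiftNat.Sections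

namespace Summit.ResolutionOfSingularities.ResolutionOfSingularities.Cruxes.EquisingularLift.StrataSplit

open Summit.ResolutionOfSingularities.ResolutionOfSingularities.Cruxes.EquisingularLiftNat.Sections
open Summit.ResolutionOfSingularities.ResolutionOfSingularities.Cruxes.EquisingularLiftNat

/-- ★★ **Regular blow-up models for every `(H, ι)` of crux `EquisingularLift` whose image has, IN SOME LINEAR COORDINATES, a first-order coordinate `ℙʳ`
as singular locus** (`K` any field with `H` integral and `ι` a closed immersion; any dimension, any degree): ✓ `blowupModel_firstOrderLine` for
`G = σ_{τ'}F` + ✓ `exists_closedImmersion_range_eq_of_linSubst` + ✓ `blowupModel_of_range_eq`. [cite: Hartshorne1977, II Example 7.1.1, II Ex. 7.12] -/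
theorem blowupModel_of_range_eq_of_linSubst_firstOrderLine {K : Type} [Field K] {m : ℕ} {H : Scheme.{0}}
    (ι : H ⟶ (projectiveSpace (m + 1 + 1) K).left) [IsClosedImmersion ι] [IsIntegral H]
    (F : MvPolynomial (Fin (m + 1 + 1 + 1)) K) {d : ℕ} (hF : F.IsHomogeneous d) (hFp : Prime F)
    (hrange : letI := MvPolynomial.gradedAlgebra (σ := Fin (m + 1 + 1 + 1)) (R := K)
      Set.range ι = {x : Proj (homogeneousSubmodule (Fin (m + 1 + 1 + 1)) K) | F ∈ x.asHomogeneousIdeal})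
    (τ τ' : Fin (m + 1 + 1 + 1) → MvPolynomial (Fin (m + 1 + 1 + 1)) K) (hτ : ∀ i, (τ i).IsHomogeneous 1) (hτ' : ∀ i, (τ' i).IsHomogeneous 1)
    (hinv : ∀ i, aeval τ (τ' i) = X i) (hinv' : ∀ i, aeval τ' (τ i) = X i)
    {r : ℕ} (e : Fin (r + 1) → Fin (m + 2 + 1)) (he : Function.Injective e)
    (hXa : ∃ a, a ∉ Set.range e ∧ (X a : MvPolynomial (Fin (m + 2 + 1)) K) ∉ Ideal.span {aeval τ' F})
    (hoff : letI := MvPolynomial.gradedAlgebra (σ := Fin (m + 2 + 1)) (R := K)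
      ∀ (hG : (aeval τ' F).IsHomogeneous d) (c : Fin (m + 2 + 1)), c ∉ Set.range e → IsRegularRing (ChartRing (aeval τ' F) c hG))
    (hfo : ∀ c ∈ Set.range e, ∃ (M : ℕ) (R : Type) (_ : CommRing R) (_ : IsDomain R)
      (σ : MvPolynomial (Fin (m + 2)) K ≃+* MvPolynomial (Fin (M + 1)) R),
      (∀ j : Fin (m + 2), c.succAbove j ∉ Set.range e → ∃ i : Fin (M + 1), σ (X j) = X i) ∧
      (∀ i : Fin (M + 1), ∃ j : Fin (m + 2), c.succAbove j ∉ Set.range e ∧ σ (X j) = X i) ∧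
      ∃ (Φ Ψ₁ Ψ' : MvPolynomial (Fin (M + 1)) R) (μ : ℕ), Φ.IsHomogeneous μ ∧ Φ ≠ 0 ∧ Ψ₁.IsHomogeneous (μ + 1) ∧
        Ψ' ∈ Ideal.span (Set.range (X : Fin (M + 1) → MvPolynomial (Fin (M + 1)) R)) ^ (μ + 2) ∧
        σ (ProjectiveSpace.dehomogenize K c (aeval τ' F)) = Φ + (Ψ₁ + Ψ') ∧
        ∃ (ι' : Type) (_ : Finite ι') (ρ : MvPolynomial ι' K ≃+* MvPolynomial (Fin (M + 1)) R) (ιz : Fin (M + 1) → ι'),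
          (∀ (j : Fin (M + 1)) (q : MvPolynomial (Fin (M + 1)) R), ρ (pderiv (ιz j) (ρ.symm q)) = pderiv j q) ∧
          (∀ v, v ∉ Set.range ιz → ∀ j : Fin (M + 1), ρ (pderiv v (ρ.symm (X j))) = 0) ∧
          (∀ v, v ∉ Set.range ιz → ∀ a : R, ∃ a' : R, ρ (pderiv v (ρ.symm (C a))) = C a') ∧
          ∀ P : Ideal (MvPolynomial (Fin (M + 1)) R), P.IsPrime → Φ ∈ P → (∀ v : ι', ρ (pderiv v (ρ.symm Φ)) ∈ P) → Ψ₁ ∈ P →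
            ∀ j, (X j : MvPolynomial (Fin (M + 1)) R) ∈ P) :
    ∃ 𝔞 : H.IdealSheafData, 𝔞 ≠ ⊥ ∧ ∀ (Z : Scheme.{0}) (π : Z ⟶ H), IsBlowup π 𝔞 → Scheme.IsRegular Z := by
  letI := MvPolynomial.gradedAlgebra (σ := Fin (m + 1 + 1 + 1)) (R := K)
  obtain ⟨ι₁, hι₁, hrange₁⟩ := exists_closedImmersion_range_eq_of_linSubst τ τ' hτ hτ' hinv hinv' ι F hrange
  haveI := hι₁
  have hG : (aeval τ' F).IsHomogeneous d := by
    have h := hF.aeval τ' hτ'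
    rwa [one_mul] at h
  exact blowupModel_of_range_eq ι₁ (aeval τ' F) hG (prime_aeval_of_linSubst τ τ' hinv hinv' hFp) hrange₁
    (blowupModel_firstOrderLine K (aeval τ' F) hG (prime_aeval_of_linSubst τ τ' hinv hinv' hFp) e he hXa (hoff hG) hfo)

end Summit.ResolutionOfSingularities.ResolutionOfSingularities.Cruxes.EquisingularLift.StrataSplit

end
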